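import Literature.NumberTheory.BeurlingPrimes.BDRPerronPoles
import HarnessLib

/-!
# BDR 2023, Theorem 3.2: the Perron inversion `N_𝒫(x) = ax + Σ_{ω>1/2} b_ω x^ω + O(x^{1/2} e^{c(log x)^{2/3}})`

Topic `Literature/NumberTheory/BeurlingPrimes`, grouping namespace `BDR`. Everything in this file is PROVED.

Broucke–Debruyne–Révész (2023), proof of Theorem 3.2, second assertion ((3.5)–(3.8) and the estimates following
them): "Since `N_𝒫(x)` is non-decreasing, we have `N_𝒫(x) ≤ ∫_x^{x+1} N_𝒫(u) du = (1/2πi)∫ ((x+1)^{s+1} − x^{s+1})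
ζ_𝒫(s) ds/(s(s+1))`, `N_𝒫(x) ≥ ∫_{x−1}^x …`. … let `σ_x = 1/2 + (log x)^{−1/3}`. We transfer the integration contour
… By the residue theorem we get `∫_x^{x+1} N_𝒫 = a(x + 1/2) + [Σ_ω u^{ω+1} b̃_ω]_x^{x+1} + (1/2πi)∫_Γ …` …
`[u^{ω+1}]_x^{x+1} = (ω+1)x^ω + O(x^{ω−1})` … it remains to show that the integral admits the error term
`O{x^{1/2}exp(c(log x)^{2/3})}` … we shall bound `(x+1)^{s+1} − x^{s+1}` by `|s|x^σ` for `|t| ≤ x` and by `O(x^{σ+1})`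
for `|t| ≥ x`."

Here (real simple poles, so a straight contour `Re s = σ_x` suffices once `x` is so large that `σ_x` lies to the
left of every pole `ω > 1/2`; the tree's engine `perron_integral_eq_residues_add`/`perron_vertical_norm_le` of
`PerronShift.lean` and the two integral estimates `BV.first_piece_le`/`BV.second_piece_le` of `BVPerron.lean` are
used verbatim, with the majorant `(Emaj/5)·B_η` of `BDRPerronPoles.norm_contZeta_le`):

* `PerronData` — the standing inputs (admissible data with `δ < 1/2`, (1.3) for `f`, `|π_P − F| ≤ A'`);
* `PerronData.shift` — the contour shift from `Re s = 3/2` to `Re s = σ_x` across the poles `T` and the vertical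
  estimate; `PerronData.abs_rieszCount_sub_sub_le` — for `1 ≤ y₁ ≤ y₂ ≤ y₁+1 ≤ x+2`,
  `|N₁(y₂) − N₁(y₁) − Σ_{p∈T} res_p (y₂^{1+p} − y₁^{1+p})/(p(p+1))| ≤ (Emaj/5)(768/2π) x^{1/2} e^{c L^{2/3}}`;
* `PerronData.abs_intCount_sub_le` — for `x` large, `|N_P(x) − ax − Σ_{ω∈S, ω>1/2} b_ω x^ω| ≤ C x^{1/2}e^{c′L^{2/3}}`
  with `a = res 1 > 0`, `b_ω = res ω/ω`, and `PerronData.intCount_clause` — **the second assertion of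
  Theorem 3.2** on `x ≥ 2` (the finitely many small `x` absorbed in the constant), with `b_ω ≠ 0` when
  `R ∩ S = ∅`.

## References
* [BrouckeDebruyneRevesz2023] F. Broucke, G. Debruyne, Sz. Gy. Révész, *Some examples of well-behaved Beurling
  number systems*, arXiv:2309.01567, proof of Theorem 3.2 ((3.5)–(3.8) and the estimates after them) (read, pp. 8–9).
* [BrouckeVindas2024] F. Broucke, J. Vindas, Math. Z. 307 (2024), arXiv:2102.08478, proof of Theorem 3.1 (the same
  Perron argument, formalised in the tree's `BVPerron.lean`).
-/

noncomputable section

open Complex Set Filter MeasureTheory Real intervalIntegral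
open scoped Topology

namespace Literature.NumberTheory.BeurlingPrimes

open Literature.Barriers.RiemannHypothesis Literature.NumberTheory.LFunctions

namespace BDR

variable {R S : Finset ℝ} {δ : ℝ} {M : ℕ} {P : BeurlingPrimes} {A A' : ℝ}

/-! ### The standing inputs -/

/-- The inputs of the Perron step: admissible data with `δ < 1/2`, the approximation (1.3) for the template
density `f`, and `|π_P − F| ≤ A'` (both supplied by Theorem 1.2 = `BrouckeVindas2024_thm12`).
[cite: BrouckeDebruyneRevesz2023, proof of Theorem 3.2] -/
structure PerronData (R S : Finset ℝ) (δ : ℝ) (M : ℕ) (P : BeurlingPrimes) (A A' : ℝ) : Prop where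
  adm : Adm R S δ M
  hδ2 : δ < 1 / 2
  approx : BV.Approx (f R S δ M) P A
  count : ∀ y : ℝ, 1 ≤ y → |(P.primeCount y : ℝ) - F R S δ M y| ≤ A'

variable (R S M P A) in
/-- The constant `C` of (3.4) on `σ ≤ 2` (`BV.CZ` for the truncated density). [cite: BrouckeDebruyneRevesz2023, Theorem 3.2 (3.4)] -/
def CZt : ℝ := BV.CZ P (apxT R S M A) (cmpK R S M)

variable (R S δ M) in
/-- The `x`-dependent factor `D_x = Emaj(η_x)/5` of the majorant. [cite: BrouckeDebruyneRevesz2023, proof of Theorem 3.2] -/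
def Dfac (x : ℝ) : ℝ := Emaj R S δ M (BV.eta x) / 5

/-- `0 ≤ C`. [folklore] -/
theorem PerronData.CZt_nonneg (hd : PerronData R S δ M P A A') : 0 ≤ CZt R S M P A := by
  have := (hd.adm.approx_fT hd.approx).nonneg
  have := BV.cmpConst_nonneg hd.adm.g_sub_fT_mem
  have := BV.E₁const_nonneg P
  unfold CZt BV.CZ apxT; positivity

/-- `1 ≤ D_x` for `x ≥ e^{64}`. [folklore] -/
theorem PerronData.one_le_Dfac (hd : PerronData R S δ M P A A') {x : ℝ} (hx : Real.exp 64 ≤ x) : 1 ≤ Dfac R S δ M x := by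
  unfold Dfac
  have := five_le_Emaj (R := R) (S := S) (M := M) hd.adm.hδ0.le hd.hδ2 (BV.eta_pos hx)
    ((BV.eta_le hx).trans (by norm_num))
  linarith

/-! ### The contour shift -/

/-- The gap condition at height `x`: `σ_x = 1/2 + η_x` stays at distance `≥ η_x` to the left of every pole `ω > 1/2`.
[cite: BrouckeDebruyneRevesz2023, proof of Theorem 3.2] -/
def GapAt (S : Finset ℝ) (x : ℝ) : Prop := ∀ ω ∈ S, 1 / 2 < ω → 2 * BV.eta x ≤ ω - 1 / 2

/-- Under the gap condition, every point `s` with `Re s = σ_x`, or `Re s = 3/2`, or `|Im s| ≥ 1`, or more generally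
with `σ_x ≤ Re s ≤ 3/2` and (`Re s = σ_x` or `Re s = 3/2` or `|Im s| ≥ 1`), is at distance `≥ η_x` from every `ω ∈ S`;
here the two forms actually used. [folklore] -/
theorem dist_pole_ge_of_re_eq {x : ℝ} (hx : Real.exp 64 ≤ x) (hgap : GapAt S x) (hS : ∀ ω ∈ S, ω < 1)
    {u : ℝ} (hu : u = 1 / 2 + BV.eta x ∨ u = 3 / 2) (t : ℝ) :
    ∀ ω ∈ S, BV.eta x ≤ ‖((u : ℂ) + t * I) - ω‖ := by
  intro ω hω
  have hη := BV.eta_pos hx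
  have hη4 := BV.eta_le hx
  have hre : |(((u : ℂ) + t * I) - ω).re| ≤ ‖((u : ℂ) + t * I) - ω‖ := Complex.abs_re_le_norm _
  simp only [sub_re, add_re, ofReal_re, mul_re, I_re, mul_zero, ofReal_im, I_im, mul_one, sub_self, add_zero] at hre
  refine le_trans ?_ hre
  rw [le_abs]
  rcases hu with rfl | rfl
  · rcases lt_or_ge (1 / 2 : ℝ) ω with hω2 | hω2
    · have := hgap ω hω hω2; right; linarith
    · left; linarith
  · left; linarith [hS ω hω]

/-- Points with `|Im s| ≥ 1` are at distance `≥ η_x` from the (real) poles. [folklore] -/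
theorem dist_pole_ge_of_im {x : ℝ} (hx : Real.exp 64 ≤ x) {u T : ℝ} (hT : 1 ≤ |T|) :
    ∀ ω ∈ S, BV.eta x ≤ ‖((u : ℂ) + T * I) - ω‖ := by
  intro ω _
  have hη4 := BV.eta_le hx
  have him : |(((u : ℂ) + T * I) - ω).im| ≤ ‖((u : ℂ) + T * I) - ω‖ := Complex.abs_im_le_norm _
  simp at him
  linarith

/-- **The contour shift** (`perron_integral_eq_residues_add` with the poles `T`, residues `res`) and the vertical
estimate on `Re s = σ_x`, for `x ≥ e^{64}` under the gap condition and `1 ≤ y₁ ≤ y₂ ≤ y₁ + 1`.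
[cite: BrouckeDebruyneRevesz2023, proof of Theorem 3.2 (3.7)–(3.8)] -/
theorem PerronData.shift (hd : PerronData R S δ M P A A') {x y₁ y₂ : ℝ} (hx : Real.exp 64 ≤ x) (hgap : GapAt S x)
    (hy₁ : 1 ≤ y₁) (hy₁₂ : y₁ ≤ y₂) (hy₂ : y₂ ≤ y₁ + 1) :
    (∫ t : ℝ, perronKernel y₁ y₂ (((3 / 2 : ℝ) : ℂ) + t * I) * contZeta R S δ M P (((3 / 2 : ℝ) : ℂ) + t * I)) =
        2 * π * (∑ p ∈ poles S, res R S δ M P p * perronKernel y₁ y₂ (p : ℂ)) +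
          ∫ t : ℝ, perronKernel y₁ y₂ (((1 / 2 + BV.eta x : ℝ) : ℂ) + t * I) *
            contZeta R S δ M P (((1 / 2 + BV.eta x : ℝ) : ℂ) + t * I) ∧
      (∫ t : ℝ, ‖perronKernel y₁ y₂ (((1 / 2 + BV.eta x : ℝ) : ℂ) + t * I) *
          contZeta R S δ M P (((1 / 2 + BV.eta x : ℝ) : ℂ) + t * I)‖) ≤
        4 * y₂ ^ (1 / 2 + BV.eta x) *
            (∫ t in Ioc 0 x, Dfac R S δ M x * BV.Bmaj (CZt R S M P A) (BV.eta x) t / (1 / 2 + BV.eta x + t)) +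
          4 * y₂ ^ (1 + (1 / 2 + BV.eta x)) *
            ∫ t in Ioi x, Dfac R S δ M x * BV.Bmaj (CZt R S M P A) (BV.eta x) t / t ^ 2 := by
  have h := hd.adm
  have hx0 := BV.x_pos hx
  have hη := BV.eta_pos hx
  have hη4 := BV.eta_le hx
  have hη1 : BV.eta x ≤ 1 := hη4.trans (by norm_num)
  have hC : 0 ≤ CZt R S M P A := hd.CZt_nonneg
  have hD : 0 ≤ Dfac R S δ M x := le_trans zero_le_one (hd.one_le_Dfac hx)
  have hy₁0 : 0 < y₁ := by linarith
  have hS1 : ∀ ω ∈ S, ω < 1 := fun ω hω ↦ (h.hS ω hω).2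
  set σ₁ : ℝ := 1 / 2 + BV.eta x with hσ₁
  have hσ₁half : (1 : ℝ) / 2 < σ₁ := by rw [hσ₁]; linarith
  -- the poles lie strictly between the two lines
  have hpoles : ∀ p ∈ poles S, σ₁ < p ∧ p < 3 / 2 := by
    intro p hp
    rcases mem_poles.mp hp with rfl | ⟨hpS, hp2⟩
    · rw [hσ₁]; constructor <;> linarith
    · have := hgap p hpS hp2
      rw [hσ₁]; constructor <;> linarith [hS1 p hpS]
  -- points on the two lines / with `|Im| ≥ 1` are not poles
  have hne_line : ∀ {u : ℝ}, (u = σ₁ ∨ u = 3 / 2) → ∀ t : ℝ, ∀ p ∈ poles S, (u : ℂ) + t * I ≠ (p : ℂ) := by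
    intro u hu t p hp heq
    have hre := congrArg Complex.re heq
    simp at hre
    obtain ⟨h1, h2⟩ := hpoles p hp
    rcases hu with rfl | rfl <;> linarith
  have hne_im : ∀ (u T : ℝ), 1 ≤ |T| → ∀ p ∈ poles S, (u : ℂ) + T * I ≠ (p : ℂ) := by
    intro u T hT p _ heq
    have him := congrArg Complex.im heq
    simp at him
    rw [him, abs_zero] at hT; linarith
  -- `G = polePart + H` at such points
  have hGeq : ∀ {u : ℝ} (t : ℝ), 1 / 2 < u → (∀ p ∈ poles S, (u : ℂ) + t * I ≠ (p : ℂ)) →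
      polePart (poles S) (res R S δ M P) ((u : ℂ) + t * I) + H R S δ M P ((u : ℂ) + t * I) =
        contZeta R S δ M P ((u : ℂ) + t * I) :=
    fun t hu hne ↦ (contZeta_eq_polePart_add_H h (by simpa using hu) hne).symm
  -- the majorant
  set B : ℝ → ℝ := fun t ↦ Dfac R S δ M x * BV.Bmaj (CZt R S M P A) (BV.eta x) t with hB
  have hB0 : 0 ≤ B 0 := mul_nonneg hD (BV.Bmaj_nonneg _ _ _)
  have hBm : Monotone B := fun t₁ t₂ ht ↦ mul_le_mul_of_nonneg_left (BV.Bmaj_mono hC hη ht) hD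
  have hBi : IntegrableOn (fun t ↦ B t / t ^ 2) (Ioi x) := by
    have := (BV.integrableOn_Bmaj_div_sq hC hx).const_mul (Dfac R S δ M x)
    refine this.congr (ae_of_all _ fun t ↦ ?_)
    simp only [hB]; ring
  have hBt : Tendsto (fun T : ℝ ↦ B T / T ^ 2) atTop (𝓝 0) := by
    have := (BV.tendsto_Bmaj_div_sq (CZt R S M P A) (BV.eta x)).const_mul (Dfac R S δ M x)
    rw [mul_zero] at this
    refine this.congr fun T ↦ ?_
    simp only [hB]; ring
  -- the bound on `G` at admissible points
  have hGbound : ∀ {u : ℝ} (t : ℝ), σ₁ ≤ u → u ≤ 3 / 2 → 1 / 4 ≤ ‖((u : ℂ) + t * I) - 1‖ →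
      (∀ ω ∈ S, BV.eta x ≤ ‖((u : ℂ) + t * I) - ω‖) → ‖contZeta R S δ M P ((u : ℂ) + t * I)‖ ≤ B |t| := by
    intro u t hu1 hu2 h1 hω
    have := norm_contZeta_le h hd.hδ2 hd.approx hd.count hη hη1 (s := (u : ℂ) + t * I)
      (by simpa [hσ₁] using hu1) (by simpa using hu2) h1 hω
    simpa [hB, Dfac, CZt] using this
  have hquarter_re : ∀ {u : ℝ} (t : ℝ), 1 / 4 ≤ |u - 1| → 1 / 4 ≤ ‖((u : ℂ) + t * I) - 1‖ := by
    intro u t hu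
    refine hu.trans ?_
    have := Complex.abs_re_le_norm (((u : ℂ) + t * I) - 1)
    simpa using this
  have hquarter_im : ∀ (u T : ℝ), 1 ≤ |T| → 1 / 4 ≤ ‖((u : ℂ) + T * I) - 1‖ := by
    intro u T hT
    have := Complex.abs_im_le_norm (((u : ℂ) + T * I) - 1)
    simp at this; linarith
  have hσ₁abs : 1 / 4 ≤ |σ₁ - 1| := by rw [hσ₁, abs_of_neg (by linarith)]; linarith
  have hκabs : 1 / 4 ≤ |(3 : ℝ) / 2 - 1| := by norm_num
  -- the bound on the two lines
  have hline : ∀ {u : ℝ} (hu : u = σ₁ ∨ u = 3 / 2) (t : ℝ), ‖contZeta R S δ M P ((u : ℂ) + t * I)‖ ≤ B |t| := by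
    intro u hu t
    have hu' : u = 1 / 2 + BV.eta x ∨ u = 3 / 2 := by rwa [hσ₁] at hu
    rcases hu with rfl | rfl
    · exact hGbound t le_rfl (by linarith) (hquarter_re t hσ₁abs) (dist_pole_ge_of_re_eq hx hgap hS1 hu' t)
    · exact hGbound t (by linarith) le_rfl (hquarter_re t hκabs) (dist_pole_ge_of_re_eq hx hgap hS1 hu' t)
  -- the bound on the strip for `|T| ≥ 1`
  have hstrip : ∀ T : ℝ, 1 ≤ |T| → ∀ u ∈ Icc σ₁ (3 / 2 : ℝ),
      ‖polePart (poles S) (res R S δ M P) ((u : ℂ) + T * I) + H R S δ M P ((u : ℂ) + T * I)‖ ≤ B |T| := by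
    intro T hT u hu
    rw [hGeq T (lt_of_lt_of_le hσ₁half hu.1) (hne_im u T hT)]
    exact hGbound T hu.1 hu.2 (hquarter_im u T hT) (dist_pole_ge_of_im hx hT)
  -- measurability on the two lines (continuity of `G` there)
  have hmeas : ∀ {u : ℝ}, (u = σ₁ ∨ u = 3 / 2) →
      AEStronglyMeasurable (fun t : ℝ ↦ polePart (poles S) (res R S δ M P) ((u : ℂ) + t * I) +
        H R S δ M P ((u : ℂ) + t * I)) volume := by
    intro u hu
    have hu2 : 1 / 2 < u := by rcases hu with rfl | rfl <;> linarith
    have hc : Continuous fun t : ℝ ↦ contZeta R S δ M P ((u : ℂ) + t * I) := by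
      refine continuous_iff_continuousAt.2 fun t ↦ ?_
      exact (differentiableAt_contZeta h hd.hδ2 hd.count (s := (u : ℂ) + t * I) (by simpa using hu2)
        (hne_line hu t)).continuousAt.comp (f := fun t : ℝ ↦ (u : ℂ) + t * I) (by fun_prop)
    exact hc.aestronglyMeasurable.congr (Eventually.of_forall fun t ↦ (hGeq t hu2 (hne_line hu t)).symm)
  -- vertical estimates on both lines
  have hV₁ := perron_vertical_norm_le (G := fun s ↦ polePart (poles S) (res R S δ M P) s + H R S δ M P s)
    (B := B) (σ := σ₁) (lt_trans (by norm_num) hσ₁half) hy₁0 hy₁₂ hy₂ hx0 (hmeas (Or.inl rfl))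
    (fun t ↦ by rw [hGeq t hσ₁half (hne_line (Or.inl rfl) t)]; exact hline (Or.inl rfl) t)
    hB0 hBm hBi
  have hVκ := perron_vertical_norm_le (G := fun s ↦ polePart (poles S) (res R S δ M P) s + H R S δ M P s)
    (B := B) (σ := (3 / 2 : ℝ)) (by norm_num) hy₁0 hy₁₂ hy₂ hx0 (hmeas (Or.inr rfl))
    (fun t ↦ by rw [hGeq t (by norm_num) (hne_line (Or.inr rfl) t)]; exact hline (Or.inr rfl) t)
    hB0 hBm hBi
  -- the residue theorem
  have hres := perron_integral_eq_residues_add (H := H R S δ M P) (B := B) (σ₀ := 1 / 2)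
    (σ₁ := σ₁) (κ := (3 / 2 : ℝ)) (y₁ := y₁) (y₂ := y₂) (T₁ := 1) (poles S) (res R S δ M P)
    (by norm_num) hσ₁half (by rw [hσ₁]; linarith) hy₁ hy₁₂ hpoles
    (differentiableOn_H h hd.hδ2 hd.count) hVκ.1 hV₁.1 hstrip hBt
  -- translate back to `contZeta`
  have hIκ : (∫ t : ℝ, perronKernel y₁ y₂ (((3 / 2 : ℝ) : ℂ) + t * I) * contZeta R S δ M P (((3 / 2 : ℝ) : ℂ) + t * I)) =
      ∫ t : ℝ, perronKernel y₁ y₂ (((3 / 2 : ℝ) : ℂ) + t * I) *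
        (polePart (poles S) (res R S δ M P) (((3 / 2 : ℝ) : ℂ) + t * I) + H R S δ M P (((3 / 2 : ℝ) : ℂ) + t * I)) :=
    integral_congr_ae (Eventually.of_forall fun t ↦ by
      beta_reduce; rw [hGeq t (by norm_num) (hne_line (Or.inr rfl) t)])
  have hI₁ : (∫ t : ℝ, perronKernel y₁ y₂ ((σ₁ : ℂ) + t * I) * contZeta R S δ M P ((σ₁ : ℂ) + t * I)) =
      ∫ t : ℝ, perronKernel y₁ y₂ ((σ₁ : ℂ) + t * I) *
        (polePart (poles S) (res R S δ M P) ((σ₁ : ℂ) + t * I) + H R S δ M P ((σ₁ : ℂ) + t * I)) :=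
    integral_congr_ae (Eventually.of_forall fun t ↦ by
      beta_reduce; rw [hGeq t hσ₁half (hne_line (Or.inl rfl) t)])
  have hI₁' : (∫ t : ℝ, ‖perronKernel y₁ y₂ ((σ₁ : ℂ) + t * I) * contZeta R S δ M P ((σ₁ : ℂ) + t * I)‖) =
      ∫ t : ℝ, ‖perronKernel y₁ y₂ ((σ₁ : ℂ) + t * I) *
        (polePart (poles S) (res R S δ M P) ((σ₁ : ℂ) + t * I) + H R S δ M P ((σ₁ : ℂ) + t * I))‖ :=
    integral_congr_ae (Eventually.of_forall fun t ↦ by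
      beta_reduce; rw [hGeq t hσ₁half (hne_line (Or.inl rfl) t)])
  refine ⟨?_, ?_⟩
  · rw [hIκ, hres, hI₁]
  · rw [hI₁']
    exact hV₁.2

/-! ### The Perron identity and the estimate for one pair `(y₁, y₂)` -/

/-- On the line `Re s = 3/2`: `N₁(y₂) − N₁(y₁) = (1/2π) ∫ K(y₁,y₂; 3/2+it) G(3/2+it) dt`.
[cite: BrouckeDebruyneRevesz2023, proof of Theorem 3.2 (3.5)–(3.6)] -/
theorem PerronData.rieszCount_sub_eq (hd : PerronData R S δ M P A A') {y₁ y₂ : ℝ} (hy₁ : 0 < y₁) (hy₂ : 0 < y₂) :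
    ((P.rieszCount y₂ - P.rieszCount y₁ : ℝ) : ℂ) =
      (1 / (2 * π) : ℂ) * ∫ t : ℝ, perronKernel y₁ y₂ (((3 / 2 : ℝ) : ℂ) + t * I) *
        contZeta R S δ M P (((3 / 2 : ℝ) : ℂ) + t * I) := by
  have hsum := hd.adm.summable_prime_rpow_neg P hd.approx (by norm_num : (1:ℝ) < 3 / 2)
  rw [P.rieszCount_sub_eq_integral hy₁ hy₂ (by norm_num : (1:ℝ) < 3 / 2) hsum]
  congr 1
  refine integral_congr_ae (Eventually.of_forall fun t ↦ ?_)
  have hs : 1 < (((3 / 2 : ℝ) : ℂ) + t * I).re := by simp; norm_num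
  show ((y₂ : ℂ) ^ (1 + (((3 / 2 : ℝ) : ℂ) + t * I)) - (y₁ : ℂ) ^ (1 + (((3 / 2 : ℝ) : ℂ) + t * I))) *
      P.zeta (((3 / 2 : ℝ) : ℂ) + t * I) *
        (1 / ((((3 / 2 : ℝ) : ℂ) + t * I) * ((((3 / 2 : ℝ) : ℂ) + t * I) + 1))) =
      perronKernel y₁ y₂ (((3 / 2 : ℝ) : ℂ) + t * I) * contZeta R S δ M P (((3 / 2 : ℝ) : ℂ) + t * I)
  rw [hd.adm.zeta_eq_E_mul_exp_Z P hd.approx hd.count hs, perronKernel, contZeta]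
  ring

/-- The kernel at a real point: `K(y₁,y₂;p) = (y₂^{1+p} − y₁^{1+p})/(p(p+1))` (`y₁, y₂ ≥ 0`). [folklore] -/
theorem perronKernel_ofReal {y₁ y₂ : ℝ} (hy₁ : 0 ≤ y₁) (hy₂ : 0 ≤ y₂) (p : ℝ) :
    perronKernel y₁ y₂ (p : ℂ) = (((y₂ ^ (1 + p) - y₁ ^ (1 + p)) / (p * (p + 1)) : ℝ) : ℂ) := by
  rw [perronKernel]
  have h1 : (1 : ℂ) + (p : ℂ) = ((1 + p : ℝ) : ℂ) := by push_cast; ring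
  rw [h1, ← Complex.ofReal_cpow hy₂, ← Complex.ofReal_cpow hy₁]
  push_cast
  ring

/-- **The Perron estimate for one pair `(y₁, y₂)`**: for `x ≥ e^{64}` under the gap condition,
`1 ≤ y₁ ≤ y₂ ≤ y₁ + 1`, `y₂ ≤ x + 1`,
`|N₁(y₂) − N₁(y₁) − Σ_{p∈T} res_p (y₂^{1+p} − y₁^{1+p})/(p(p+1))| ≤ D_x (768/2π) x^{1/2} e^{c L^{2/3}}`.
[cite: BrouckeDebruyneRevesz2023, proof of Theorem 3.2 (3.7)–(3.8)] -/
theorem PerronData.abs_rieszCount_sub_sub_le (hd : PerronData R S δ M P A A') {x y₁ y₂ : ℝ}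
    (hx : Real.exp 64 ≤ x) (hgap : GapAt S x) (hy₁ : 1 ≤ y₁) (hy₁₂ : y₁ ≤ y₂) (hy₂ : y₂ ≤ y₁ + 1)
    (hy₂x : y₂ ≤ x + 1) :
    |P.rieszCount y₂ - P.rieszCount y₁ -
        ∑ p ∈ poles S, resR R S δ M P p * ((y₂ ^ (1 + p) - y₁ ^ (1 + p)) / (p * (p + 1)))| ≤
      Dfac R S δ M x * (768 / (2 * π)) *
        (x ^ (1 / 2 : ℝ) * Real.exp (BV.cexpo (CZt R S M P A) * Real.log x ^ (2 / 3 : ℝ))) := by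
  have hy₁0 : 0 < y₁ := by linarith
  have hy₂0 : 0 < y₂ := by linarith
  have hC : 0 ≤ CZt R S M P A := hd.CZt_nonneg
  have hD : 0 ≤ Dfac R S δ M x := le_trans zero_le_one (hd.one_le_Dfac hx)
  obtain ⟨hshift, hvert⟩ := hd.shift hx hgap hy₁ hy₁₂ hy₂
  set Iσ : ℂ := ∫ t : ℝ, perronKernel y₁ y₂ (((1 / 2 + BV.eta x : ℝ) : ℂ) + t * I) *
    contZeta R S δ M P (((1 / 2 + BV.eta x : ℝ) : ℂ) + t * I) with hIσ
  set Mt : ℝ := ∑ p ∈ poles S, resR R S δ M P p * ((y₂ ^ (1 + p) - y₁ ^ (1 + p)) / (p * (p + 1))) with hMt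
  -- the residue sum is the real number `Mt`
  have hsumR : ∑ p ∈ poles S, res R S δ M P p * perronKernel y₁ y₂ (p : ℂ) = ((Mt : ℝ) : ℂ) := by
    rw [hMt]; push_cast
    refine Finset.sum_congr rfl fun p _ ↦ ?_
    rw [res_eq_ofReal, perronKernel_ofReal hy₁0.le hy₂0.le]
    push_cast
    ring
  -- the identity `ΔN₁ = Mt + Re(Iσ)/(2π)`
  have hid : ((P.rieszCount y₂ - P.rieszCount y₁ : ℝ) : ℂ) = ((Mt : ℝ) : ℂ) + (1 / (2 * π) : ℂ) * Iσ := by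
    rw [hd.rieszCount_sub_eq hy₁0 hy₂0, hshift, hsumR, mul_add]
    congr 1
    have hπ : (π : ℂ) ≠ 0 := by exact_mod_cast Real.pi_pos.ne'
    field_simp
  have hre : P.rieszCount y₂ - P.rieszCount y₁ = Mt + 1 / (2 * π) * Iσ.re := by
    have := congrArg Complex.re hid
    rw [ofReal_re, add_re, ofReal_re] at this
    rw [this]
    congr 1
    have h1 : (1 / (2 * π) : ℂ) = ((1 / (2 * π) : ℝ) : ℂ) := by push_cast; ring
    rw [h1, Complex.re_ofReal_mul]
  -- the estimate of the shifted integral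
  have hI : ‖Iσ‖ ≤ Dfac R S δ M x * (768 * (x ^ (1 / 2 : ℝ) *
      Real.exp (BV.cexpo (CZt R S M P A) * Real.log x ^ (2 / 3 : ℝ)))) := by
    refine (MeasureTheory.norm_integral_le_integral_norm _).trans (hvert.trans ?_)
    have h1 := BV.first_piece_le hC hx hy₂0 hy₂x
    have h2 := BV.second_piece_le hC hx hy₂0 hy₂x
    have e1 : ∫ t in Ioc 0 x, Dfac R S δ M x * BV.Bmaj (CZt R S M P A) (BV.eta x) t / (1 / 2 + BV.eta x + t) =
        Dfac R S δ M x * ∫ t in Ioc 0 x, BV.Bmaj (CZt R S M P A) (BV.eta x) t / (1 / 2 + BV.eta x + t) := by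
      rw [← MeasureTheory.integral_const_mul]
      exact integral_congr_ae (Eventually.of_forall fun t ↦ by ring)
    have e2 : ∫ t in Ioi x, Dfac R S δ M x * BV.Bmaj (CZt R S M P A) (BV.eta x) t / t ^ 2 =
        Dfac R S δ M x * ∫ t in Ioi x, BV.Bmaj (CZt R S M P A) (BV.eta x) t / t ^ 2 := by
      rw [← MeasureTheory.integral_const_mul]
      exact integral_congr_ae (Eventually.of_forall fun t ↦ by ring)
    rw [e1, e2]
    have hy₂pow : 0 ≤ 4 * y₂ ^ (1 / 2 + BV.eta x) := by positivity
    have hy₂pow' : 0 ≤ 4 * y₂ ^ (1 + (1 / 2 + BV.eta x)) := by positivity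
    nlinarith [mul_le_mul_of_nonneg_left h1 hD, mul_le_mul_of_nonneg_left h2 hD]
  rw [hre, add_sub_cancel_left, abs_mul, abs_of_pos (by positivity : 0 < 1 / (2 * π))]
  calc 1 / (2 * π) * |Iσ.re| ≤ 1 / (2 * π) * (Dfac R S δ M x * (768 * (x ^ (1 / 2 : ℝ) *
        Real.exp (BV.cexpo (CZt R S M P A) * Real.log x ^ (2 / 3 : ℝ))))) :=
        mul_le_mul_of_nonneg_left ((Complex.abs_re_le_norm _).trans hI) (by positivity)
    _ = Dfac R S δ M x * (768 / (2 * π)) *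
        (x ^ (1 / 2 : ℝ) * Real.exp (BV.cexpo (CZt R S M P A) * Real.log x ^ (2 / 3 : ℝ))) := by ring


/-! ### The main terms -/

/-- **`[u^{ω+1}/(ω+1)]_y^{y+1} = y^ω + O(1)`**: for `y ≥ 1`, `0 < ω ≤ 1`,
`y^ω ≤ ((y+1)^{1+ω} − y^{1+ω})/(1+ω) ≤ y^ω + 1` (it is `∫_y^{y+1} u^ω du`, and `(y+1)^ω ≤ y^ω + 1`).
[cite: BrouckeDebruyneRevesz2023, proof of Theorem 3.2 ("`[u^{ω+1}]_x^{x+1} = (ω+1)x^ω + O(x^{ω−1})`")] -/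
theorem rpow_succ_sub_div_mem {y ω : ℝ} (hy : 1 ≤ y) (hω0 : 0 < ω) (hω1 : ω ≤ 1) :
    y ^ ω ≤ ((y + 1) ^ (1 + ω) - y ^ (1 + ω)) / (1 + ω) ∧
      ((y + 1) ^ (1 + ω) - y ^ (1 + ω)) / (1 + ω) ≤ y ^ ω + 1 := by
  have hy0 : 0 ≤ y := by linarith
  have hint : ∫ u in y..(y + 1), u ^ ω = ((y + 1) ^ (1 + ω) - y ^ (1 + ω)) / (1 + ω) := by
    rw [integral_rpow (Or.inl (by linarith)), add_comm ω 1]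
  rw [← hint]
  have hi : ∀ c : ℝ, IntervalIntegrable (fun _ ↦ c) volume y (y + 1) := fun c ↦ intervalIntegrable_const
  have hrpow : IntervalIntegrable (fun u : ℝ ↦ u ^ ω) volume y (y + 1) := by
    refine (ContinuousOn.rpow_const continuousOn_id fun u hu ↦ Or.inl ?_).intervalIntegrable
    rw [uIcc_of_le (by linarith)] at hu
    exact (show (0 : ℝ) < u from by linarith [hu.1]).ne'
  constructor
  · have := intervalIntegral.integral_mono_on (by linarith) (hi (y ^ ω)) hrpow fun u hu ↦
      Real.rpow_le_rpow hy0 hu.1 hω0.le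
    simpa using this
  · have h1 : ∀ u ∈ Icc y (y + 1), u ^ ω ≤ y ^ ω + 1 := by
      intro u hu
      calc u ^ ω ≤ (y + 1) ^ ω := Real.rpow_le_rpow (by linarith [hu.1]) hu.2 hω0.le
        _ ≤ y ^ ω + (1 : ℝ) ^ ω := Real.rpow_add_le_add_rpow hy0 zero_le_one hω0.le hω1
        _ = y ^ ω + 1 := by rw [Real.one_rpow]
    have := intervalIntegral.integral_mono_on (by linarith) hrpow (hi (y ^ ω + 1)) h1
    simpa using this

/-- The residue sum split into the pole at `1` and the poles `ω ∈ S`, `ω > 1/2`: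
`Σ_{p∈T} res_p (y₂^{1+p} − y₁^{1+p})/(p(p+1)) = a (y₂² − y₁²)/2 + Σ_ω b_ω (y₂^{1+ω} − y₁^{1+ω})/(1+ω)`
with `a = res 1`, `b_ω = res ω/ω`. [cite: BrouckeDebruyneRevesz2023, proof of Theorem 3.2 (3.7)] -/
theorem sum_poles_eq (hS : ∀ ω ∈ S, 0 < ω ∧ ω < 1) (y₁ y₂ : ℝ) :
    ∑ p ∈ poles S, resR R S δ M P p * ((y₂ ^ (1 + p) - y₁ ^ (1 + p)) / (p * (p + 1))) =
      resR R S δ M P 1 * ((y₂ ^ 2 - y₁ ^ 2) / 2) +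
        ∑ ω ∈ S with 1 / 2 < ω, resR R S δ M P ω / ω * ((y₂ ^ (1 + ω) - y₁ ^ (1 + ω)) / (1 + ω)) := by
  rw [poles, Finset.sum_insert]
  · congr 1
    · have h2 : (1 : ℝ) + 1 = (2 : ℕ) := by norm_num
      rw [h2, Real.rpow_natCast, Real.rpow_natCast]; ring
    · refine Finset.sum_congr rfl fun ω hω ↦ ?_
      have hω0 : ω ≠ 0 := (hS ω (Finset.mem_filter.mp hω).1).1.ne'
      field_simp
      ring
  · intro h1
    exact absurd (hS 1 (Finset.mem_filter.mp h1).1).2 (lt_irrefl 1)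

/-- The main terms differ from `Σ_ω b_ω x^ω` by at most `Σ_ω |b_ω|` (each `[u^{1+ω}/(1+ω)]` bracket is within `1`
of `x^ω`). [cite: BrouckeDebruyneRevesz2023, proof of Theorem 3.2] -/
theorem abs_sum_sub_le (b J : ℝ → ℝ) (x : ℝ) (T : Finset ℝ) (hJ : ∀ ω ∈ T, |J ω - x ^ ω| ≤ 1) :
    |∑ ω ∈ T, b ω * J ω - ∑ ω ∈ T, b ω * x ^ ω| ≤ ∑ ω ∈ T, |b ω| := by
  rw [← Finset.sum_sub_distrib]
  refine (Finset.abs_sum_le_sum_abs _ _).trans (Finset.sum_le_sum fun ω hω ↦ ?_)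
  rw [← mul_sub, abs_mul]
  exact mul_le_of_le_one_right (abs_nonneg _) (hJ ω hω)

/-- **The integer clause for large `x`**: for `x ≥ e^{64}` under the gap condition,
`|N_P(x) − ax − Σ_{ω∈S, ω>1/2} b_ω x^ω| ≤ (a/2 + Σ|b_ω| + 128 D_x) x^{1/2} e^{c L^{2/3}}`
(`N₁(x) − N₁(x−1) ≤ N(x) ≤ N₁(x+1) − N₁(x)`). [cite: BrouckeDebruyneRevesz2023, Theorem 3.2 (second assertion)] -/
theorem PerronData.abs_intCount_sub_le (hd : PerronData R S δ M P A A') {x : ℝ} (hx : Real.exp 64 ≤ x)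
    (hgap : GapAt S x) :
    |(P.intCount x : ℝ) - resR R S δ M P 1 * x -
        ∑ ω ∈ S with 1 / 2 < ω, resR R S δ M P ω / ω * x ^ ω| ≤
      (resR R S δ M P 1 / 2 + ∑ ω ∈ S with 1 / 2 < ω, |resR R S δ M P ω / ω| + 128 * Dfac R S δ M x) *
        (x ^ (1 / 2 : ℝ) * Real.exp (BV.cexpo (CZt R S M P A) * Real.log x ^ (2 / 3 : ℝ))) := by
  have h := hd.adm
  have hx2 : 2 ≤ x := le_trans (by have := Real.add_one_le_exp (64:ℝ); linarith) hx
  have hx1 : 1 ≤ x := by linarith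
  have ha0 : 0 < resR R S δ M P 1 := resR_one_pos h
  have hD1 := hd.one_le_Dfac hx
  set Xf : ℝ := x ^ (1 / 2 : ℝ) * Real.exp (BV.cexpo (CZt R S M P A) * Real.log x ^ (2 / 3 : ℝ)) with hXf
  have hXf1 : 1 ≤ Xf := by
    have h1 : 1 ≤ x ^ (1 / 2 : ℝ) := Real.one_le_rpow hx1 (by norm_num)
    have h2 : 1 ≤ Real.exp (BV.cexpo (CZt R S M P A) * Real.log x ^ (2 / 3 : ℝ)) := by
      refine Real.one_le_exp (mul_nonneg ?_ (Real.rpow_nonneg (Real.log_nonneg hx1) _))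
      have := hd.CZt_nonneg; unfold BV.cexpo; positivity
    rw [hXf]; nlinarith
  set T' := S.filter (fun ω ↦ 1 / 2 < ω) with hT'
  set a := resR R S δ M P 1 with ha
  set b : ℝ → ℝ := fun ω ↦ resR R S δ M P ω / ω with hb
  have hS01 : ∀ ω ∈ S, 0 < ω ∧ ω < 1 := h.hS
  have hT'S : ∀ ω ∈ T', 0 < ω ∧ ω ≤ 1 := fun ω hω ↦
    ⟨(hS01 ω (Finset.mem_filter.mp hω).1).1, (hS01 ω (Finset.mem_filter.mp hω).1).2.le⟩
  -- the two Perron estimates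
  have hup := hd.abs_rieszCount_sub_sub_le hx hgap hx1 (by linarith : x ≤ x + 1) le_rfl le_rfl
  have hlo := hd.abs_rieszCount_sub_sub_le hx hgap (by linarith : (1:ℝ) ≤ x - 1) (by linarith : x - 1 ≤ x)
    (by linarith) (by linarith)
  rw [sum_poles_eq hS01] at hup hlo
  have e1 : ((x + 1) ^ 2 - x ^ 2) / 2 = x + 1 / 2 := by ring
  have e2 : (x ^ 2 - (x - 1) ^ 2) / 2 = x - 1 / 2 := by ring
  rw [e1] at hup
  rw [e2] at hlo
  -- the brackets versus `x^ω`
  have hJup : |∑ ω ∈ T', b ω * (((x + 1) ^ (1 + ω) - x ^ (1 + ω)) / (1 + ω)) - ∑ ω ∈ T', b ω * x ^ ω| ≤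
      ∑ ω ∈ T', |b ω| := by
    refine abs_sum_sub_le b _ x T' fun ω hω ↦ ?_
    obtain ⟨h1, h2⟩ := rpow_succ_sub_div_mem hx1 (hT'S ω hω).1 (hT'S ω hω).2
    rw [abs_le]; constructor <;> linarith
  have hJlo : |∑ ω ∈ T', b ω * ((x ^ (1 + ω) - (x - 1) ^ (1 + ω)) / (1 + ω)) - ∑ ω ∈ T', b ω * x ^ ω| ≤
      ∑ ω ∈ T', |b ω| := by
    refine abs_sum_sub_le b _ x T' fun ω hω ↦ ?_
    obtain ⟨hω0, hω1⟩ := hT'S ω hω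
    obtain ⟨h1, h2⟩ := rpow_succ_sub_div_mem (by linarith : (1:ℝ) ≤ x - 1) hω0 hω1
    rw [show x - 1 + 1 = x by ring] at h1 h2
    have h3 : (x - 1) ^ ω ≤ x ^ ω := Real.rpow_le_rpow (by linarith) (by linarith) hω0.le
    have h4 : x ^ ω ≤ (x - 1) ^ ω + 1 := by
      calc x ^ ω = ((x - 1) + 1) ^ ω := by ring_nf
        _ ≤ (x - 1) ^ ω + (1 : ℝ) ^ ω := Real.rpow_add_le_add_rpow (by linarith) zero_le_one hω0.le hω1
        _ = (x - 1) ^ ω + 1 := by rw [Real.one_rpow]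
    rw [abs_le]; constructor <;> linarith
  -- sandwich
  have hN_up := P.intCount_le_rieszCount_sub x
  have hN_lo := P.rieszCount_sub_le_intCount x
  have hπ : 768 / (2 * π) ≤ 128 := by
    rw [div_le_iff₀ (by positivity)]; have := Real.pi_gt_three; nlinarith
  have hD0 : 0 ≤ Dfac R S δ M x := by linarith
  have hErr : Dfac R S δ M x * (768 / (2 * π)) * Xf ≤ 128 * Dfac R S δ M x * Xf := by
    have : 0 ≤ Dfac R S δ M x * Xf := by nlinarith
    nlinarith
  have hsb : 0 ≤ ∑ ω ∈ T', |b ω| := Finset.sum_nonneg fun _ _ ↦ abs_nonneg _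
  rw [abs_le] at hup hlo hJup hJlo ⊢
  obtain ⟨hup1, hup2⟩ := hup
  obtain ⟨hlo1, hlo2⟩ := hlo
  obtain ⟨hJup1, hJup2⟩ := hJup
  obtain ⟨hJlo1, hJlo2⟩ := hJlo
  constructor
  · nlinarith
  · nlinarith

/-! ### Absorbing `D_x` and the small `x` -/

variable (R S δ M) in
/-- The `x`-free part of `D_x`: `D₀ = 2^{|S|} 3^{|R|} (1 + δ/(1/2−δ))^M`. [cite: BrouckeDebruyneRevesz2023, proof of Theorem 3.2] -/
def Dzero : ℝ := 2 ^ S.card * 3 ^ R.card * (1 + δ / (1 / 2 - δ)) ^ M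

/-- **`D_x ≤ D₀ e^{(|S|/2) L^{2/3}}`** for `x ≥ e^{64}` (`(2/η)^{|S|} = 2^{|S|} L^{|S|/3}` and
`L^{1/3} = e^{(1/3) log L} ≤ e^{(1/2)L^{2/3}}`). [cite: BrouckeDebruyneRevesz2023, proof of Theorem 3.2] -/
theorem Dfac_le (hδ0 : 0 ≤ δ) (hδ2 : δ < 1 / 2) {x : ℝ} (hx : Real.exp 64 ≤ x) :
    Dfac R S δ M x ≤ Dzero R S δ M * Real.exp (S.card / 2 * Real.log x ^ (2 / 3 : ℝ)) := by
  have hL := BV.log_ge hx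
  have hη := BV.eta_pos hx
  set L := Real.log x with hLdef
  have hL0 : 0 < L := by linarith
  -- `2/η = 2 L^{1/3} ≤ 2 e^{(1/2) L^{2/3}}`
  have h1 : 2 / BV.eta x = 2 * L ^ (1 / 3 : ℝ) := by rw [div_eq_mul_one_div, BV.one_div_eta hx]
  have h2 : L ^ (1 / 3 : ℝ) ≤ Real.exp (1 / 2 * L ^ (2 / 3 : ℝ)) := by
    have hlog : Real.log L ≤ L ^ (2 / 3 : ℝ) / (2 / 3) := Real.log_le_rpow_div hL0.le (by norm_num)
    rw [Real.rpow_def_of_pos hL0]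
    refine Real.exp_le_exp.mpr ?_
    have : Real.log L * (1 / 3) ≤ (L ^ (2 / 3 : ℝ) / (2 / 3)) * (1 / 3) := by nlinarith
    linarith [this]
  have h3 : (2 / BV.eta x) ^ S.card ≤ (2 * Real.exp (1 / 2 * L ^ (2 / 3 : ℝ))) ^ S.card := by
    rw [h1]
    exact pow_le_pow_left₀ (by positivity) (by nlinarith [Real.rpow_nonneg hL0.le (1 / 3 : ℝ)]) _
  have h4 : (2 * Real.exp (1 / 2 * L ^ (2 / 3 : ℝ))) ^ S.card =
      2 ^ S.card * Real.exp (S.card / 2 * L ^ (2 / 3 : ℝ)) := by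
    rw [mul_pow, ← Real.exp_nat_mul]; congr 1; congr 1; ring
  have hrest : 0 ≤ (3 : ℝ) ^ R.card * (1 + δ / (1 / 2 - δ)) ^ M := by
    have : 0 ≤ δ / (1 / 2 - δ) := div_nonneg hδ0 (by linarith)
    positivity
  unfold Dfac Emaj Dzero
  calc 5 * (2 / BV.eta x) ^ S.card * 3 ^ R.card * (1 + δ / (1 / 2 - δ)) ^ M / 5
      = (2 / BV.eta x) ^ S.card * (3 ^ R.card * (1 + δ / (1 / 2 - δ)) ^ M) := by ring
    _ ≤ (2 ^ S.card * Real.exp (S.card / 2 * L ^ (2 / 3 : ℝ))) * (3 ^ R.card * (1 + δ / (1 / 2 - δ)) ^ M) := by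
        rw [← h4]; exact mul_le_mul_of_nonneg_right h3 hrest
    _ = 2 ^ S.card * 3 ^ R.card * (1 + δ / (1 / 2 - δ)) ^ M * Real.exp (S.card / 2 * L ^ (2 / 3 : ℝ)) := by ring

/-- **The gap condition holds for all large `x`** (`η_x → 0` and `S` is finite), with a threshold `X₀ ≥ e^{64}`.
[cite: BrouckeDebruyneRevesz2023, proof of Theorem 3.2 (choice of `σ_x`)] -/
theorem exists_gapAt (S : Finset ℝ) : ∃ X₀ : ℝ, Real.exp 64 ≤ X₀ ∧ ∀ x : ℝ, X₀ ≤ x → GapAt S x := by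
  have hη : Tendsto BV.eta atTop (𝓝 0) :=
    (tendsto_rpow_neg_atTop (by norm_num : (0:ℝ) < 1 / 3)).comp Real.tendsto_log_atTop
  have hη2 : Tendsto (fun x ↦ 2 * BV.eta x) atTop (𝓝 0) := by
    have := hη.const_mul 2; rwa [mul_zero] at this
  have hev : ∀ᶠ x in atTop, ∀ ω ∈ S, 1 / 2 < ω → 2 * BV.eta x ≤ ω - 1 / 2 := by
    rw [Filter.eventually_all_finset]
    intro ω _
    by_cases hω : 1 / 2 < ω
    · have := hη2.eventually (Iic_mem_nhds (show (0:ℝ) < ω - 1 / 2 by linarith))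
      filter_upwards [this] with x hx using fun _ ↦ hx
    · exact Eventually.of_forall fun x h ↦ absurd h hω
  obtain ⟨X₀, hX₀⟩ := (hev.and (eventually_ge_atTop (Real.exp 64))).exists_forall_of_atTop
  exact ⟨X₀, (hX₀ X₀ le_rfl).2, fun x hx ↦ (hX₀ x hx).1⟩

/-- **BDR Theorem 3.2, second assertion** (in the vendored shape): there are `a > 0`, `c > 0`, `C` and
`b : ℝ → ℝ` with `b_ω ≠ 0` for `ω ∈ S`, `ω > 1/2` (when `R ∩ S = ∅`), such that for all `x ≥ 2`
`|N_P(x) − (ax + Σ_{ω∈S, ω>1/2} b_ω x^ω)| ≤ C x^{1/2} exp(c (log x)^{2/3})`.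
[cite: BrouckeDebruyneRevesz2023, Theorem 3.2 (second assertion)] -/
theorem PerronData.intCount_clause (hd : PerronData R S δ M P A A') (hRS : Disjoint R S) :
    ∃ (a c C : ℝ) (b : ℝ → ℝ), 0 < a ∧ 0 < c ∧ (∀ ω ∈ S, 1 / 2 < ω → b ω ≠ 0) ∧
      ∀ x : ℝ, 2 ≤ x →
        |(P.intCount x : ℝ) - (a * x + ∑ ω ∈ S with 1 / 2 < ω, b ω * x ^ ω)|
          ≤ C * (x ^ (1 / 2 : ℝ) * Real.exp (c * Real.log x ^ (2 / 3 : ℝ))) := by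
  have h := hd.adm
  obtain ⟨X₀, hX₀, hgap⟩ := exists_gapAt S
  set a := resR R S δ M P 1 with ha
  set b : ℝ → ℝ := fun ω ↦ resR R S δ M P ω / ω with hb
  set T' := S.filter (fun ω ↦ 1 / 2 < ω) with hT'
  set c₀ := BV.cexpo (CZt R S M P A) with hc₀
  set c := c₀ + S.card / 2 with hc
  set Bsmall : ℝ := (P.intCount X₀ : ℝ) + a * X₀ + (∑ ω ∈ T', |b ω|) * X₀ with hBsmall
  have ha0 : 0 < a := resR_one_pos h
  have hc₀0 : 0 < c₀ := by have := hd.CZt_nonneg; rw [hc₀]; unfold BV.cexpo; positivity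
  have hc0 : 0 < c := by rw [hc]; positivity
  have hsb : 0 ≤ ∑ ω ∈ T', |b ω| := Finset.sum_nonneg fun _ _ ↦ abs_nonneg _
  have hX₀1 : 1 ≤ X₀ := le_trans (by have := Real.add_one_le_exp (64:ℝ); linarith) hX₀
  have hBsmall0 : 0 ≤ Bsmall := by rw [hBsmall]; positivity
  have hD₀ : 0 ≤ Dzero R S δ M := by
    unfold Dzero; have : 0 ≤ δ / (1 / 2 - δ) := div_nonneg h.hδ0.le (by linarith [hd.hδ2]); positivity
  refine ⟨a, c, (a / 2 + ∑ ω ∈ T', |b ω| + 128 * Dzero R S δ M) + Bsmall, b, ha0, hc0, ?_, fun x hx ↦ ?_⟩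
  · intro ω hω hω2
    exact div_ne_zero (resR_ne_zero hRS hd.hδ2 hω hω2) (by linarith)
  have hx1 : 1 ≤ x := by linarith
  have hL0 : 0 ≤ Real.log x := Real.log_nonneg hx1
  set Xg : ℝ := x ^ (1 / 2 : ℝ) * Real.exp (c * Real.log x ^ (2 / 3 : ℝ)) with hXg
  have hXg1 : 1 ≤ Xg := by
    have h1 : 1 ≤ x ^ (1 / 2 : ℝ) := Real.one_le_rpow hx1 (by norm_num)
    have h2 : 1 ≤ Real.exp (c * Real.log x ^ (2 / 3 : ℝ)) :=
      Real.one_le_exp (mul_nonneg hc0.le (Real.rpow_nonneg hL0 _))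
    rw [hXg]; nlinarith
  rcases le_or_gt X₀ x with hxX | hxX
  · -- large `x`
    have hxe : Real.exp 64 ≤ x := hX₀.trans hxX
    have hmain := hd.abs_intCount_sub_le hxe (hgap x hxX)
    have hDx := Dfac_le (R := R) (S := S) (M := M) h.hδ0.le hd.hδ2 hxe
    have hDx0 : 0 ≤ Dfac R S δ M x := le_trans zero_le_one (hd.one_le_Dfac hxe)
    -- `D_x · e^{c₀ L^{2/3}} ≤ D₀ e^{c L^{2/3}}`
    have hexp : Dfac R S δ M x * Real.exp (c₀ * Real.log x ^ (2 / 3 : ℝ)) ≤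
        Dzero R S δ M * Real.exp (c * Real.log x ^ (2 / 3 : ℝ)) := by
      calc Dfac R S δ M x * Real.exp (c₀ * Real.log x ^ (2 / 3 : ℝ))
          ≤ Dzero R S δ M * Real.exp (S.card / 2 * Real.log x ^ (2 / 3 : ℝ)) *
              Real.exp (c₀ * Real.log x ^ (2 / 3 : ℝ)) :=
            mul_le_mul_of_nonneg_right hDx (Real.exp_pos _).le
        _ = Dzero R S δ M * Real.exp (c * Real.log x ^ (2 / 3 : ℝ)) := by
            rw [mul_assoc, ← Real.exp_add]; congr 1; congr 1; rw [hc]; ring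
    have hexp' : Real.exp (c₀ * Real.log x ^ (2 / 3 : ℝ)) ≤ Real.exp (c * Real.log x ^ (2 / 3 : ℝ)) := by
      refine Real.exp_le_exp.mpr (mul_le_mul_of_nonneg_right ?_ (Real.rpow_nonneg hL0 _))
      rw [hc]; have : (0:ℝ) ≤ S.card / 2 := by positivity
      linarith
    have hx12 : 0 ≤ x ^ (1 / 2 : ℝ) := Real.rpow_nonneg (by linarith) _
    have hkey : (a / 2 + ∑ ω ∈ T', |b ω| + 128 * Dfac R S δ M x) *
        (x ^ (1 / 2 : ℝ) * Real.exp (c₀ * Real.log x ^ (2 / 3 : ℝ))) ≤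
        (a / 2 + ∑ ω ∈ T', |b ω| + 128 * Dzero R S δ M) * Xg := by
      rw [hXg]
      have h1 : (a / 2 + ∑ ω ∈ T', |b ω|) * (x ^ (1 / 2 : ℝ) * Real.exp (c₀ * Real.log x ^ (2 / 3 : ℝ))) ≤
          (a / 2 + ∑ ω ∈ T', |b ω|) * (x ^ (1 / 2 : ℝ) * Real.exp (c * Real.log x ^ (2 / 3 : ℝ))) :=
        mul_le_mul_of_nonneg_left (mul_le_mul_of_nonneg_left hexp' hx12) (by positivity)
      have h2 : 128 * Dfac R S δ M x * (x ^ (1 / 2 : ℝ) * Real.exp (c₀ * Real.log x ^ (2 / 3 : ℝ))) ≤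
          128 * Dzero R S δ M * (x ^ (1 / 2 : ℝ) * Real.exp (c * Real.log x ^ (2 / 3 : ℝ))) := by
        have := mul_le_mul_of_nonneg_left hexp hx12
        nlinarith
      nlinarith
    have hrew : (P.intCount x : ℝ) - (a * x + ∑ ω ∈ T', b ω * x ^ ω) =
        (P.intCount x : ℝ) - resR R S δ M P 1 * x - ∑ ω ∈ T', resR R S δ M P ω / ω * x ^ ω := by
      rw [ha, hb]; ring
    rw [hrew]
    calc _ ≤ _ := hmain
      _ ≤ (a / 2 + ∑ ω ∈ T', |b ω| + 128 * Dzero R S δ M) * Xg := hkey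
      _ ≤ ((a / 2 + ∑ ω ∈ T', |b ω| + 128 * Dzero R S δ M) + Bsmall) * Xg := by nlinarith
  · -- small `x`: `|N(x) − ax − Σ b x^ω| ≤ N(X₀) + a X₀ + Σ|b| X₀ = Bsmall ≤ Bsmall · Xg`
    have hN : ((P.intCount x : ℝ)) ≤ P.intCount X₀ := by exact_mod_cast P.intCount_mono hxX.le
    have hN0 : (0 : ℝ) ≤ P.intCount x := Nat.cast_nonneg _
    have hsum : |∑ ω ∈ T', b ω * x ^ ω| ≤ (∑ ω ∈ T', |b ω|) * X₀ := by
      rw [Finset.sum_mul]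
      refine (Finset.abs_sum_le_sum_abs _ _).trans (Finset.sum_le_sum fun ω hω ↦ ?_)
      obtain ⟨hω0, hω1⟩ := h.hS ω (Finset.mem_filter.mp hω).1
      rw [abs_mul, abs_of_nonneg (Real.rpow_nonneg (by linarith) _)]
      refine mul_le_mul_of_nonneg_left ?_ (abs_nonneg _)
      calc x ^ ω ≤ x ^ (1 : ℝ) := Real.rpow_le_rpow_of_exponent_le hx1 hω1.le
        _ = x := Real.rpow_one x
        _ ≤ X₀ := hxX.le
    have h1 : |(P.intCount x : ℝ) - (a * x + ∑ ω ∈ T', b ω * x ^ ω)| ≤ Bsmall := by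
      rw [abs_le] at hsum ⊢
      have hax : a * x ≤ a * X₀ := mul_le_mul_of_nonneg_left hxX.le ha0.le
      have hax0 : 0 ≤ a * x := by positivity
      rw [hBsmall]
      constructor <;> linarith [hsum.1, hsum.2]
    calc _ ≤ Bsmall := h1
      _ ≤ Bsmall * Xg := le_mul_of_one_le_right hBsmall0 hXg1
      _ ≤ ((a / 2 + ∑ ω ∈ T', |b ω| + 128 * Dzero R S δ M) + Bsmall) * Xg := by
          have : 0 ≤ (a / 2 + ∑ ω ∈ T', |b ω| + 128 * Dzero R S δ M) * Xg := by
            have : 0 ≤ a / 2 + ∑ ω ∈ T', |b ω| + 128 * Dzero R S δ M := by positivity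
            nlinarith
          nlinarith

end BDR

end Literature.NumberTheory.BeurlingPrimes
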